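import Mathlib

/-!
# Pair cells of the quotient profile: the fibre-concentration bound

Helper file for programme B (line `transport-split-hull`) on the crux
`SnSubsetDichotomy.PolynomialSlack` (stmt-MatrixMultiplication-8306).

For `T U ⊆ S_n` and positions `j j' k k'`, the *pair cell*
`{(t, u) ∈ T × U : u k = t j, u k' = t j'}` counts the joint realisations of the two cells
`(j, k)` and `(j', k')` of the quotient `B = T⁻¹ U`.  Splitting the pair cell by the common value
`v = t j = u k` and bounding the second condition by the concentration of the fibre
`{u ∈ U : u k = v}` at the position `k'` gives

* `card_pairCell_le_sum_card_mul_sup` :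
  `#{(t, u) : u k = t j ∧ u k' = t j'} ≤ ∑ v, #{t ∈ T : t j = v} * max_{v'} #{u ∈ U : u k = v ∧ u k' = v'}`;
* `card_pairCell_le_sum_card_mul_sup'` : the same bound with the roles of `T` and `U` exchanged,
  `≤ ∑ v, #{u ∈ U : u k = v} * max_{v'} #{t ∈ T : t j = v ∧ t j' = v'}`.

These replace the crude `(n - 2)!`-bound on the joint realisation of two heavy cells by the
member-level "conditional spreadness" of `U` (resp. `T`).  The proofs are pure double counting
on the product finset (`Finset.card_eq_sum_card_fiberwise`,
`Finset.card_le_mul_card_image_of_maps_to`); no TPP hypothesis and no injectivity is used.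
-/

namespace Summit.MatrixMultiplication.MatrixMultiplication.Theorems.PolynomialSlack

set_option linter.dupNamespace false

open scoped BigOperators

/-- **Pair-cell bound by the fibre concentration of `U`.**  The number of pairs
`(t, u) ∈ T × U` with `u k = t j` and `u k' = t j'` is at most
`∑ v, #{t ∈ T : t j = v} * max_{v'} #{u ∈ U : u k = v ∧ u k' = v'}`: split by `v = t j`, then
for each `t` the admissible `u` lie in the fibre `{u ∈ U : u k = v ∧ u k' = t j'}`. [folklore] -/
theorem card_pairCell_le_sum_card_mul_sup {n : ℕ} (T U : Finset (Equiv.Perm (Fin n)))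
    (j j' k k' : Fin n) :
    ((T ×ˢ U).filter fun tu : Equiv.Perm (Fin n) × Equiv.Perm (Fin n) =>
        tu.2 k = tu.1 j ∧ tu.2 k' = tu.1 j').card ≤
      ∑ v : Fin n, (T.filter fun t => t j = v).card *
        Finset.univ.sup (fun v' : Fin n => (U.filter fun u => u k = v ∧ u k' = v').card) := by
  -- split the pair cell by the common value `v = t j`
  refine (Finset.card_eq_sum_card_fiberwise
    (f := fun tu : Equiv.Perm (Fin n) × Equiv.Perm (Fin n) => tu.1 j) (t := Finset.univ)
    fun _ _ => Finset.mem_coe.2 (Finset.mem_univ _)).trans_le ?_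
  refine Finset.sum_le_sum fun v _ => ?_
  rw [mul_comm]
  -- for fixed `v`, fibre over `t ∈ {t ∈ T : t j = v}`
  refine Finset.card_le_mul_card_image_of_maps_to (f := Prod.fst)
    (t := T.filter fun t => t j = v) ?_ _ ?_
  · intro tu htu
    simp only [Finset.mem_filter, Finset.mem_product] at htu
    exact Finset.mem_filter.2 ⟨htu.1.1.1, htu.2⟩
  · intro t _
    -- the fibre over `t` embeds (via `u`) into `{u ∈ U : u k = v ∧ u k' = t j'}`
    refine le_trans (Finset.card_le_card_of_injOn Prod.snd ?_ ?_)
      (Finset.le_sup (f := fun v' : Fin n => (U.filter fun u => u k = v ∧ u k' = v').card)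
        (Finset.mem_univ (t j')))
    · intro tu htu
      simp only [Finset.mem_coe, Finset.mem_filter, Finset.mem_product] at htu
      obtain ⟨⟨⟨⟨-, hu⟩, hk, hk'⟩, hv⟩, rfl⟩ := htu
      exact Finset.mem_coe.2 (Finset.mem_filter.2 ⟨hu, hk.trans hv, hk'⟩)
    · intro a ha b hb hab
      simp only [Finset.mem_coe, Finset.mem_filter] at ha hb
      exact Prod.ext (ha.2.trans hb.2.symm) hab

/-- **Pair-cell bound by the fibre concentration of `T`.**  The number of pairs
`(t, u) ∈ T × U` with `u k = t j` and `u k' = t j'` is at most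
`∑ v, #{u ∈ U : u k = v} * max_{v'} #{t ∈ T : t j = v ∧ t j' = v'}`: split by `v = u k`, then
for each `u` the admissible `t` lie in the fibre `{t ∈ T : t j = v ∧ t j' = u k'}`. [folklore] -/
theorem card_pairCell_le_sum_card_mul_sup' {n : ℕ} (T U : Finset (Equiv.Perm (Fin n)))
    (j j' k k' : Fin n) :
    ((T ×ˢ U).filter fun tu : Equiv.Perm (Fin n) × Equiv.Perm (Fin n) =>
        tu.2 k = tu.1 j ∧ tu.2 k' = tu.1 j').card ≤
      ∑ v : Fin n, (U.filter fun u => u k = v).card *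
        Finset.univ.sup (fun v' : Fin n => (T.filter fun t => t j = v ∧ t j' = v').card) := by
  -- split the pair cell by the common value `v = u k`
  refine (Finset.card_eq_sum_card_fiberwise
    (f := fun tu : Equiv.Perm (Fin n) × Equiv.Perm (Fin n) => tu.2 k) (t := Finset.univ)
    fun _ _ => Finset.mem_coe.2 (Finset.mem_univ _)).trans_le ?_
  refine Finset.sum_le_sum fun v _ => ?_
  rw [mul_comm]
  -- for fixed `v`, fibre over `u ∈ {u ∈ U : u k = v}`
  refine Finset.card_le_mul_card_image_of_maps_to (f := Prod.snd)
    (t := U.filter fun u => u k = v) ?_ _ ?_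
  · intro tu htu
    simp only [Finset.mem_filter, Finset.mem_product] at htu
    exact Finset.mem_filter.2 ⟨htu.1.1.2, htu.2⟩
  · intro u _
    -- the fibre over `u` embeds (via `t`) into `{t ∈ T : t j = v ∧ t j' = u k'}`
    refine le_trans (Finset.card_le_card_of_injOn Prod.fst ?_ ?_)
      (Finset.le_sup (f := fun v' : Fin n => (T.filter fun t => t j = v ∧ t j' = v').card)
        (Finset.mem_univ (u k')))
    · intro tu htu
      simp only [Finset.mem_coe, Finset.mem_filter, Finset.mem_product] at htu
      obtain ⟨⟨⟨⟨ht, -⟩, hk, hk'⟩, hv⟩, rfl⟩ := htu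
      exact Finset.mem_coe.2 (Finset.mem_filter.2 ⟨ht, hk.symm.trans hv, hk'.symm⟩)
    · intro a ha b hb hab
      simp only [Finset.mem_coe, Finset.mem_filter] at ha hb
      exact Prod.ext hab (ha.2.trans hb.2.symm)

end Summit.MatrixMultiplication.MatrixMultiplication.Theorems.PolynomialSlack
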